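import Summits.QuantumFields.YangMills.Theorems.UnitScaleTiltProp7CovariantBlockPoincare
import HarnessLib

/-!
# Route `UnitScaleTilt`, crux K1 child «MinimiserStabilityRegPr» (stmt-QuantumFields-19200), registered stub `stub_prop7From14` (v4 828f5fb4a904d3be;
# leaf V3 «Prop 7 from a background (14)» = `T3Thm1CarrierNative.Prop7From14At`) — sub-lemma V3-D2, part 3/3: THE `k`-UNIFORM POINCARÉ–COERCIVITY OF THE
# STRAIGHT-LINE BLOCK AVERAGING AT A NON-FLAT SMALL-FIELD BACKGROUND, in gauge-invariant (covariant) form, constants independent of the volume and of `k`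

Cell `ym3-torus` ∕ fleet seat `ym-ust-19200-p1` (HUMAN RULING D-0037, YM ladder rung R3), successor g2.  WHERE THIS SITS.  [Balaban1985Variational] Prop. 7
(p. 299) is proved in print from a background `U₀` satisfying (14) — small PLAQUETTE variables `|U₀(∂p) − 1| < ε₀η²`, NOT small bond variables — through the
positivity of the linearised operator `Δ₁(U₀) + D R D^* + aQ^*Q` ([Balaban1985BackgroundPropagators] Thm 3.11 p. 416: the lower bound `γ₀η²`-uniform in `k` for
backgrounds in `𝔘_k(ε)`, `ε` «sufficiently small» ABSOLUTELY).  The predecessor seat landed the FLAT case `U₀ = 1` of the averaging term in `L²` form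
(`UnitScaleTiltProp7FlatCoercivity` p451004: `Σ_b X² ≤ 2L^{kd}Σ_c(M_kX)² + (17/8)L^{2k}Σ‖∇X‖²`).  THIS FILE is the NON-FLAT case (card V3-D2): the same
`L^{−2k}` lower bound for the COVARIANT straight-line block averaging and the COVARIANT gradient at a unitary background `V` whose plaquette variables are
within `a` of `1`, with an error `N d³((L^k)²a)²·Σ‖Y‖²` that is ABSOLUTE (`= N d³ε²`) at print's scaling `a = εL^{−2k}` — so it is absorbed for `ε` small
independently of `k` and of the volume, exactly as Thm 3.11 asserts.  Only the plaquette variables of the background enter (gauge invariance): no gauge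
fixing of `U₀` to bond variables near `1` is assumed — the proof fixes the comb (axial) gauge BLOCK BY BLOCK, where the tree's axial-gauge bond bound
`|V₀,b − 1| ≤ |b₋ − y|₁·a` ([Balaban1985Averaging] pp. 24–25, `B7Prop1Explicit.axial_bond_bound`) makes the bond defects `≤ d·L^k·a = dεL^{−k}`, whose
square against the Poincaré factor `(L^k)²` is the absolute `d²ε²`.

WHAT IS PROVED (sorry-free, no definition; our own statements — [folklore] ∕ cited to the printed step they instantiate; `R(u)X = uXu⁻¹` is the tree's
`B7Eq78Linearization.conjR`, transports are the tree's `B10Eq27TorusAxialLog.holT`, the comb contour is `B7Prop1Explicit.treeWord`; parts 1/3 and 2/3 are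
`UnitScaleTiltProp7CovariantTransport` (kinematics, `norm_conjR_comb_sub_le`) and `UnitScaleTiltProp7CovariantBlockPoincare` (`block_poincare_comb`, `blockMean_cov_le`)):
* §5 **`sum_normSq_le_covLineAvg_add_covGrad_dir`** (one direction) and §6 **`sum_normSq_le_covLineAvg_add_covGrad`** (bond fields):
  `Σ_b‖Y(b)‖² ≤ 2N(L^{ed}L^{2e})^{−1}Σ_c‖A^V_cY‖² + (9N/4)(L^e)²Σ_bΣ_ν‖(∇^V_νY)(b)‖² + N d³((L^e)²a)²Σ_b‖Y(b)‖²`, with `A^V_{⟨y,μ⟩}Y = Σ_{x∈B^e(y)}Σ_{t<L^e}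
  R(V(Γ_{ȳ,x})V([x,x+te_μ]))Y(x+te_μ, μ)` (un-normalised covariant straight-line block average, comb transport to the block corner `ȳ`) and
  `(∇^V_νY)(x,μ) = R(V(x,x+e_ν))Y(x+e_ν,μ) − Y(x,μ)`; **`sum_normSq_le_covGrad_of_covLineAvg_eq_zero`**: `N d³((L^e)²a)² ≤ ½ ∧ A^VY = 0 ⇒
  (L^e)^{−2}Σ‖Y‖² ≤ (9N/2)Σ‖∇^VY‖²`; `hyp_of_specialUnitary`, `…_su` — `SU(N)` backgrounds read through `unitsField ∘ toUField` (the letters of the carrier's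
  `T3PrintedRegularMinimiser.DivSmall`) with `dist1 (U₀(∂p)) ≤ a`; **`sum_normSq_le_covGrad_of_covLineAvg_eq_zero_T3`** — at the d = 3 carrier (`Site (F.P K) 0`,
  `e = K − n`, `SU(2)`): `dist1(U₀(∂p)) ≤ εL^{−2(K−n)}`, `108ε² ≤ 1`, `A^{U₀}Y = 0 ⇒ L^{−2(K−n)}Σ_b‖Y(b)‖² ≤ 9Σ_bΣ_ν‖(∇^{U₀}_νY)(b)‖²`, uniformly in `m`, `n`, `K`.

WHAT THIS IS NOT.  Not Thm 3.11 itself: the covariant curl–divergence (Weitzenböck) form with its curvature commutators, the residual-gauge projection `R` of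
[Balaban1984PropagatorsI] (1.72), the identification of `A^V` with the derivative of the family's (0.4)-descent `descendTo` at `U₀` (print's `Q(U₀)`: the
`exp`-mean-`log` of non-constant transporters and the contour corrections), and the sup-norm ∕ decay theory of Thms 3.12–3.13 are further sub-lemmas of the
leaf's split card (item evidence `CARD-19200-V3-split.md`: D1b′, D1c, D3).  Nothing of Bałaban's is asserted.

References: T. Bałaban, CMP 99 (1985) 389–434 [Balaban1985BackgroundPropagators] (Thm 3.11 p.416); CMP 95 (1984) 17–40 [Balaban1984PropagatorsI] (Prop. 1.1
(1.90) p.33, (1.18) p.20); CMP 98 (1985) 17–51 [Balaban1985Averaging] ((8)–(9) pp.18–19, (19)–(20) p.21, pp.24–25, (56) p.27); CMP 99 (1985) 75–102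
[Balaban1985RegularSpaces] ((1.1) p.76); CMP 89 (1983) 571–597 [Balaban1983RegularityDecay] ((2.27) p.580); CMP 102 (1985) 277–309 [Balaban1985Variational]
(Prop. 7 p.299, (14) p.280).
-/

noncomputable section

open scoped BigOperators Matrix.Norms.L2Operator

namespace Summit.QuantumFields.YangMills.Theorems.Prop7CovariantCoercivity

open Literature.MathematicalPhysics.QuantumFieldTheory.Balaban1983to89
open Finset B1RG242Torus
open B7Prop1Explicit renaming Site → LSite
open B7Prop1Explicit (Letter e hol treeWord axialFn disp plaqWord l1 U1 hol_append disp_treeWord gaugeAct axial_bond_bound hol_mem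
  disp_replicate)
open B7Eq78Linearization (conjR conjR_apply conjR_sub conjR_add)
open B8Ineq132 (norm_conjR conjR_conjR one_conjR)
open B10Eq27TorusAxialLog (transl transl_zero transl_add transl_add_e pull pull_apply holT holT_append hol_pull hol_pull_zero holT_nil
  holT_cons_true)

variable {N : ℕ} [NeZero N]

/-! ## §5 The covariant Poincaré–coercivity on the torus -/

section Assembly

open Beta.CoordCubePoincare (stepUp)
open B5Leaf237C0Torus (bsite bsite_stepUp sum_bsite proj_bsite)

variable {P : Params} {i i' e : ℕ}

omit [NeZero N] in
/-- The block corner in the two offset spellings. [folklore] -/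
theorem bsite_zero_eq_fibreSite {n : ℕ} (hn : n + 1 = P.L ^ e) (y : Site P i') :
    bsite P i e hn y (fun _ => 0) = Site.fibreSite i e y (fun _ => ⟨0, pow_pos P.L_pos e⟩) := by
  funext ν
  simp [bsite, Site.fibreSite]

/-- **ONE DIRECTION** — for a unitary background `V` on `T^{(i)}` whose plaquette variables are within `a` of `1` and every `M_N(ℂ)`-valued site function `f`
(read: the `μ`-components `x ↦ Y(x, μ)` of a bond field):
`Σ_x ‖f(x)‖² ≤ 2N(L^{ed}L^{2e})^{−1}·Σ_y ‖A^V_{y,μ}f‖² + 2N(L^e)²·Σ_x ‖(∇^V_μ f)(x)‖² + (N/4)(L^e)²·Σ_ν Σ_x ‖(∇^V_ν f)(x)‖² + N d³((L^e)²a)²·Σ_x ‖f(x)‖²`,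
where `A^V_{y,μ}f = Σ_{x∈B^e(y)} Σ_{t<L^e} R(V(Γ_{ȳ,x})·V([x, x+te_μ])) f(x + te_μ)` is the COVARIANT straight-line block average (un-normalised; comb transport to the
block corner `ȳ` after the straight transport) and `(∇^V_ν f)(x) = R(V(x,x+e_ν))f(x+e_ν) − f(x)`.  For `a = ε·L^{−2e}` the last coefficient is `N d³ ε²`:
the constants are uniform in the volume and in `e`. [cite: Balaban1985BackgroundPropagators, Thm 3.11 p.416; Balaban1984PropagatorsI, Prop. 1.1 (1.90) p.33] -/
theorem sum_normSq_le_covLineAvg_add_covGrad_dir {V : GaugeField P i (Matrix (Fin N) (Fin N) ℂ)ˣ} (hV : ∀ b, V b ∈ U1 (Matrix (Fin N) (Fin N) ℂ))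
    {a : ℝ} (ha : 0 ≤ a)
    (hplaq : ∀ (x : Site P i) (κ μ : Fin P.d), κ ≠ μ → ‖((holT V x (plaqWord κ μ) : (Matrix (Fin N) (Fin N) ℂ)ˣ) : Matrix (Fin N) (Fin N) ℂ) - 1‖ ≤ a)
    (h : P.sitesPerDir i = P.L ^ e * P.sitesPerDir i') (f : Site P i → Matrix (Fin N) (Fin N) ℂ) (μ : Fin P.d) :
    ∑ x : Site P i, ‖f x‖ ^ 2
      ≤ 2 * N * ((((P.L : ℝ) ^ e) ^ P.d) * ((P.L : ℝ) ^ e) ^ 2)⁻¹ *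
          ∑ y : Site P i', ‖∑ r : Fin P.d → Fin (P.L ^ e), ∑ t ∈ range (P.L ^ e),
              conjR (holT V (Site.fibreSite i e y fun _ => ⟨0, pow_pos P.L_pos e⟩) (treeWord fun ν => ((r ν : ℕ) : ℤ))
                  * holT V (Site.fibreSite i e y r) (List.replicate t (μ, true)))
                (f ((fun z : Site P i => z.shift μ)^[t] (Site.fibreSite i e y r)))‖ ^ 2
        + 2 * N * ((P.L : ℝ) ^ e) ^ 2 * ∑ x : Site P i, ‖conjR (V ⟨x, μ⟩) (f (x.shift μ)) - f x‖ ^ 2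
        + (N / 4) * ((P.L : ℝ) ^ e) ^ 2 * ∑ ν : Fin P.d, ∑ x : Site P i, ‖conjR (V ⟨x, ν⟩) (f (x.shift ν)) - f x‖ ^ 2
        + N * P.d ^ 3 * (((P.L : ℝ) ^ e) ^ 2 * a) ^ 2 * ∑ x : Site P i, ‖f x‖ ^ 2 := by
  obtain ⟨n, hn⟩ : ∃ n, n + 1 = P.L ^ e := ⟨P.L ^ e - 1, Nat.sub_add_cancel (Nat.one_le_pow _ _ P.L_pos)⟩
  have hLe : ((P.L : ℝ) ^ e) = (n : ℝ) + 1 := by exact_mod_cast hn.symm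
  -- abbreviations
  set D : Fin P.d → Site P i → ℝ := fun ν x => ‖conjR (V ⟨x, ν⟩) (f (x.shift ν)) - f x‖ ^ 2 with hD
  set Av : Site P i' → Matrix (Fin N) (Fin N) ℂ := fun y => ∑ r : Fin P.d → Fin (n + 1), ∑ t ∈ range (n + 1),
      conjR (holT V (bsite P i e hn y fun _ => 0) (treeWord fun ν => ((r ν : ℕ) : ℤ))
          * holT V (bsite P i e hn y r) (List.replicate t (μ, true)))
        (f ((fun z : Site P i => z.shift μ)^[t] (bsite P i e hn y r))) with hAv
  -- (1) per block: the comb-gauge Poincaré and the telescoping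
  have hper : ∀ y : Site P i', ∑ r : Fin P.d → Fin (n + 1), ‖f (bsite P i e hn y r)‖ ^ 2
      ≤ (N / 4) * ((n : ℝ) + 1) ^ 2 * ∑ ν : Fin P.d, ∑ r ∈ univ.filter (fun r : Fin P.d → Fin (n + 1) => r ν ≠ Fin.last n), D ν (bsite P i e hn y r)
        + N * (P.d * ((P.d * n * a) ^ 2 * ((n : ℝ) + 1) ^ 2)) * ∑ r : Fin P.d → Fin (n + 1), ‖f (bsite P i e hn y r)‖ ^ 2
        + N * (2 * (((n : ℝ) + 1) ^ P.d * ((n : ℝ) + 1) ^ 2)⁻¹ * ‖Av y‖ ^ 2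
          + 2 * ((n : ℝ) + 1) * ∑ s ∈ range (n + 1), ∑ r : Fin P.d → Fin (n + 1), D μ ((fun z : Site P i => z.shift μ)^[s] (bsite P i e hn y r))) := by
    intro y
    have h1 := block_poincare_comb hV ha hplaq hn y f
    have h2 := blockMean_cov_le hV hn y μ f
    have hN : (0 : ℝ) ≤ N := Nat.cast_nonneg _
    have h3 := mul_le_mul_of_nonneg_left h2 hN
    simp only [hD, hAv]
    linarith [h1, h3]
  -- (2) sum over the blocks
  have hsum := Finset.sum_le_sum fun y (_ : y ∈ (Finset.univ : Finset (Site P i'))) => hper y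
  rw [← sum_bsite P h hn (fun x => ‖f x‖ ^ 2)] at hsum
  simp only [Finset.sum_add_distrib, ← Finset.mul_sum, mul_add] at hsum
  -- (3) the global sums
  have eG : ∀ ν : Fin P.d, ∑ y : Site P i', ∑ r ∈ univ.filter (fun r : Fin P.d → Fin (n + 1) => r ν ≠ Fin.last n), D ν (bsite P i e hn y r)
      ≤ ∑ x : Site P i, D ν x := by
    intro ν
    rw [sum_bsite P h hn (D ν)]
    exact Finset.sum_le_sum fun y _ => Finset.sum_le_sum_of_subset_of_nonneg (Finset.filter_subset _ _) fun _ _ _ => by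
      simp only [hD]; exact sq_nonneg _
  have eG' : ∑ y : Site P i', ∑ ν : Fin P.d, ∑ r ∈ univ.filter (fun r : Fin P.d → Fin (n + 1) => r ν ≠ Fin.last n), D ν (bsite P i e hn y r)
      ≤ ∑ ν : Fin P.d, ∑ x : Site P i, D ν x := by
    rw [Finset.sum_comm]
    exact Finset.sum_le_sum fun ν _ => eG ν
  have eF : ∑ y : Site P i', ∑ r : Fin P.d → Fin (n + 1), ‖f (bsite P i e hn y r)‖ ^ 2 = ∑ x : Site P i, ‖f x‖ ^ 2 :=
    (sum_bsite P h hn (fun x => ‖f x‖ ^ 2)).symm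
  have eH : ∑ y : Site P i', ∑ s ∈ range (n + 1), ∑ r : Fin P.d → Fin (n + 1), D μ ((fun z : Site P i => z.shift μ)^[s] (bsite P i e hn y r))
      = ((n : ℝ) + 1) * ∑ x : Site P i, D μ x := by
    rw [Finset.sum_comm]
    have : ∀ s, ∑ y : Site P i', ∑ r : Fin P.d → Fin (n + 1), D μ ((fun z : Site P i => z.shift μ)^[s] (bsite P i e hn y r))
        = ∑ x : Site P i, D μ x := by
      intro s
      rw [← sum_bsite P h hn (fun x => D μ ((fun z : Site P i => z.shift μ)^[s] x))]
      exact Prop7FlatCoercivity.sum_iterShift μ (D μ) s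
    simp only [this, Finset.sum_const, Finset.card_range, nsmul_eq_mul]
    push_cast; ring
  have eA : ∑ y : Site P i', ‖Av y‖ ^ 2 = ∑ y : Site P i', ‖∑ r : Fin P.d → Fin (P.L ^ e), ∑ t ∈ range (P.L ^ e),
      conjR (holT V (Site.fibreSite i e y fun _ => ⟨0, pow_pos P.L_pos e⟩) (treeWord fun ν => ((r ν : ℕ) : ℤ))
          * holT V (Site.fibreSite i e y r) (List.replicate t (μ, true)))
        (f ((fun z : Site P i => z.shift μ)^[t] (Site.fibreSite i e y r)))‖ ^ 2 := by
    refine Finset.sum_congr rfl fun y _ => ?_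
    have hr : range (n + 1) = range (P.L ^ e) := by rw [hn]
    simp only [hAv]
    rw [hr, ← bsite_zero_eq_fibreSite hn y]
    congr 2
    exact (Equiv.piCongrRight fun _ : Fin P.d => finCongr hn).sum_comp
      (fun r : Fin P.d → Fin (P.L ^ e) => ∑ t ∈ range (P.L ^ e),
        conjR (holT V (bsite P i e hn y fun _ => 0) (treeWord fun ν => ((r ν : ℕ) : ℤ))
            * holT V (Site.fibreSite i e y r) (List.replicate t (μ, true)))
          (f ((fun z : Site P i => z.shift μ)^[t] (Site.fibreSite i e y r))))
  -- (4) the coefficient of the zeroth-order term: `d·(dna)²·(n+1)² ≤ d³((n+1)²a)²`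
  have hS0 : 0 ≤ ∑ x : Site P i, ‖f x‖ ^ 2 := Finset.sum_nonneg fun _ _ => sq_nonneg _
  have hcoef : (N : ℝ) * (P.d * ((P.d * n * a) ^ 2 * ((n : ℝ) + 1) ^ 2)) ≤ N * P.d ^ 3 * ((((n : ℝ) + 1) ^ 2) * a) ^ 2 := by
    have hn1 : (n : ℝ) ≤ (n : ℝ) + 1 := by linarith
    have hn0 : (0 : ℝ) ≤ n := Nat.cast_nonneg _
    have hd0 : (0 : ℝ) ≤ P.d := Nat.cast_nonneg _
    have hN0 : (0 : ℝ) ≤ N := Nat.cast_nonneg _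
    have e1 : (N : ℝ) * (P.d * ((P.d * n * a) ^ 2 * ((n : ℝ) + 1) ^ 2)) = N * P.d ^ 3 * a ^ 2 * ((n : ℝ) + 1) ^ 2 * (n : ℝ) ^ 2 := by ring
    have e2 : (N : ℝ) * P.d ^ 3 * ((((n : ℝ) + 1) ^ 2) * a) ^ 2 = N * P.d ^ 3 * a ^ 2 * ((n : ℝ) + 1) ^ 2 * ((n : ℝ) + 1) ^ 2 := by ring
    rw [e1, e2]
    have : (n : ℝ) ^ 2 ≤ ((n : ℝ) + 1) ^ 2 := pow_le_pow_left₀ hn0 hn1 2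
    exact mul_le_mul_of_nonneg_left this (by positivity)
  have hgradN : (0 : ℝ) ≤ (N / 4) * ((n : ℝ) + 1) ^ 2 := by positivity
  have hm1 := mul_le_mul_of_nonneg_left eG' hgradN
  have hm2 := mul_le_mul_of_nonneg_right hcoef hS0
  rw [hLe, ← eA]
  rw [eF, eH] at hsum
  simp only [hD] at hsum hm1 eG' ⊢
  nlinarith [hsum, hm1, hm2]

end Assembly


/-! ## §6 Bond fields: the covariant `e`-fold Poincaré–coercivity, its small-field form on the kernel of the covariant averaging, `SU(N)` backgrounds,
and the d = 3 carrier -/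

section BondFields

open B10StarCount (sum_pbond)
open B10Eq27TorusAxialLog (unitsField toUField norm_holT_unitsField_plaqWord_sub_one dist1_plaqHol_toUField unitsField_mem_unitaryUnits
  holT_plaqWord_swap)
open B7Prop2Explicit (unitaryUnits_le_U1)

variable {P : Params} {i i' e : ℕ}

/-- **THE COVARIANT `e`-FOLD POINCARÉ–COERCIVITY OF THE STRAIGHT-LINE BLOCK AVERAGING AT A SMALL-FIELD BACKGROUND** (the averaging-term core of
[Balaban1985BackgroundPropagators] Thm 3.11 ∕ [Balaban1984PropagatorsI] (1.90), at a NON-FLAT unitary background `V` on `T^{(i)}` whose plaquette variables are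
within `a` of `1`, `L²` form, fine-lattice units): for every `M_N(ℂ)`-valued bond field `Y`,
`Σ_b ‖Y(b)‖² ≤ 2N(L^{ed}L^{2e})^{−1}·Σ_{c=⟨y,μ⟩} ‖A^V_c Y‖² + (9N/4)(L^e)²·Σ_b Σ_ν ‖(∇^V_ν Y)(b)‖² + N d³((L^e)²a)²·Σ_b ‖Y(b)‖²`,
`A^V_{⟨y,μ⟩}Y = Σ_{x∈B^e(y)} Σ_{t<L^e} R(V(Γ_{ȳ,x})V([x, x+te_μ])) Y(x+te_μ, μ)` the covariant straight-line block average (un-normalised; comb transport to the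
block corner `ȳ` after the straight transport), `(∇^V_νY)(x, μ) = R(V(x,x+e_ν))Y(x+e_ν, μ) − Y(x, μ)`.  At `a = ε L^{−2e}` (print's (6): `|U(∂p) − 1| < ε₀η²`,
`η = L^{−k}`) the last coefficient is the ABSOLUTE number `N d³ ε²`: uniform in the volume and in `e`.
[cite: Balaban1985BackgroundPropagators, Thm 3.11 p.416; Balaban1984PropagatorsI, Prop. 1.1 (1.90) p.33] -/
theorem sum_normSq_le_covLineAvg_add_covGrad {V : GaugeField P i (Matrix (Fin N) (Fin N) ℂ)ˣ} (hV : ∀ b, V b ∈ U1 (Matrix (Fin N) (Fin N) ℂ))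
    {a : ℝ} (ha : 0 ≤ a)
    (hplaq : ∀ (x : Site P i) (κ μ : Fin P.d), κ ≠ μ → ‖((holT V x (plaqWord κ μ) : (Matrix (Fin N) (Fin N) ℂ)ˣ) : Matrix (Fin N) (Fin N) ℂ) - 1‖ ≤ a)
    (h : P.sitesPerDir i = P.L ^ e * P.sitesPerDir i') (Y : PBond P i → Matrix (Fin N) (Fin N) ℂ) :
    ∑ b : PBond P i, ‖Y b‖ ^ 2
      ≤ 2 * N * ((((P.L : ℝ) ^ e) ^ P.d) * ((P.L : ℝ) ^ e) ^ 2)⁻¹ *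
          ∑ c : PBond P i', ‖∑ r : Fin P.d → Fin (P.L ^ e), ∑ t ∈ range (P.L ^ e),
              conjR (holT V (Site.fibreSite i e c.src fun _ => ⟨0, pow_pos P.L_pos e⟩) (treeWord fun ν => ((r ν : ℕ) : ℤ))
                  * holT V (Site.fibreSite i e c.src r) (List.replicate t (c.dir, true)))
                (Y ⟨(fun z : Site P i => z.shift c.dir)^[t] (Site.fibreSite i e c.src r), c.dir⟩)‖ ^ 2
        + (9 * N / 4) * ((P.L : ℝ) ^ e) ^ 2 * ∑ b : PBond P i, ∑ ν : Fin P.d, ‖conjR (V ⟨b.src, ν⟩) (Y ⟨b.src.shift ν, b.dir⟩) - Y b‖ ^ 2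
        + N * P.d ^ 3 * (((P.L : ℝ) ^ e) ^ 2 * a) ^ 2 * ∑ b : PBond P i, ‖Y b‖ ^ 2 := by
  -- per direction
  have hdir := fun μ : Fin P.d => sum_normSq_le_covLineAvg_add_covGrad_dir hV ha hplaq h (fun x => Y ⟨x, μ⟩) μ
  have hsum := Finset.sum_le_sum fun μ (_ : μ ∈ (Finset.univ : Finset (Fin P.d))) => hdir μ
  simp only [Finset.sum_add_distrib, ← Finset.mul_sum] at hsum
  -- the bond sums as sums over directions
  have eL : ∑ b : PBond P i, ‖Y b‖ ^ 2 = ∑ μ : Fin P.d, ∑ x : Site P i, ‖Y ⟨x, μ⟩‖ ^ 2 := by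
    rw [sum_pbond, Finset.sum_comm]
  have eA : ∑ c : PBond P i', ‖∑ r : Fin P.d → Fin (P.L ^ e), ∑ t ∈ range (P.L ^ e),
        conjR (holT V (Site.fibreSite i e c.src fun _ => ⟨0, pow_pos P.L_pos e⟩) (treeWord fun ν => ((r ν : ℕ) : ℤ))
            * holT V (Site.fibreSite i e c.src r) (List.replicate t (c.dir, true)))
          (Y ⟨(fun z : Site P i => z.shift c.dir)^[t] (Site.fibreSite i e c.src r), c.dir⟩)‖ ^ 2
      = ∑ μ : Fin P.d, ∑ y : Site P i', ‖∑ r : Fin P.d → Fin (P.L ^ e), ∑ t ∈ range (P.L ^ e),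
        conjR (holT V (Site.fibreSite i e y fun _ => ⟨0, pow_pos P.L_pos e⟩) (treeWord fun ν => ((r ν : ℕ) : ℤ))
            * holT V (Site.fibreSite i e y r) (List.replicate t (μ, true)))
          (Y ⟨(fun z : Site P i => z.shift μ)^[t] (Site.fibreSite i e y r), μ⟩)‖ ^ 2 := by
    rw [sum_pbond, Finset.sum_comm]
  have eG : ∑ b : PBond P i, ∑ ν : Fin P.d, ‖conjR (V ⟨b.src, ν⟩) (Y ⟨b.src.shift ν, b.dir⟩) - Y b‖ ^ 2
      = ∑ μ : Fin P.d, ∑ ν : Fin P.d, ∑ x : Site P i, ‖conjR (V ⟨x, ν⟩) (Y ⟨x.shift ν, μ⟩) - Y ⟨x, μ⟩‖ ^ 2 := by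
    rw [sum_pbond, Finset.sum_comm]
    exact Finset.sum_congr rfl fun μ _ => Finset.sum_comm
  -- the longitudinal derivative is one of the `ν`-derivatives
  have hone : ∑ μ : Fin P.d, ∑ x : Site P i, ‖conjR (V ⟨x, μ⟩) (Y ⟨x.shift μ, μ⟩) - Y ⟨x, μ⟩‖ ^ 2
      ≤ ∑ μ : Fin P.d, ∑ ν : Fin P.d, ∑ x : Site P i, ‖conjR (V ⟨x, ν⟩) (Y ⟨x.shift ν, μ⟩) - Y ⟨x, μ⟩‖ ^ 2 :=
    Finset.sum_le_sum fun μ _ => Finset.single_le_sum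
      (f := fun ν : Fin P.d => ∑ x : Site P i, ‖conjR (V ⟨x, ν⟩) (Y ⟨x.shift ν, μ⟩) - Y ⟨x, μ⟩‖ ^ 2)
      (fun ν _ => Finset.sum_nonneg fun _ _ => sq_nonneg _) (Finset.mem_univ μ)
  have hL0 : (0 : ℝ) ≤ 2 * N * ((P.L : ℝ) ^ e) ^ 2 := by positivity
  have hm := mul_le_mul_of_nonneg_left hone hL0
  rw [eL, eA, eG]
  linarith [hsum, hm]

/-- **SMALL-FIELD FORM ON THE KERNEL OF THE COVARIANT AVERAGING** ([Balaban1985BackgroundPropagators] Thm 3.11's mechanism at the `L²` level): if the plaquette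
variables of `V` are within `a` of `1` with `N d³((L^e)²a)² ≤ ½` (i.e. `a = εL^{−2e}`, `ε ≤ (2N d³)^{−1/2}` — an ABSOLUTE smallness, print's «ε₀ sufficiently
small») and the covariant straight-line block averages of `Y` vanish, then `(L^e)^{−2}·Σ_b ‖Y(b)‖² ≤ (9N/2)·Σ_b Σ_ν ‖(∇^V_νY)(b)‖²` — the `η² = L^{−2e}` lower
bound of the covariant gradient form on `ker A^V`, constants independent of the volume and of `e`. [cite: Balaban1985BackgroundPropagators, Thm 3.11 p.416] -/
theorem sum_normSq_le_covGrad_of_covLineAvg_eq_zero {V : GaugeField P i (Matrix (Fin N) (Fin N) ℂ)ˣ} (hV : ∀ b, V b ∈ U1 (Matrix (Fin N) (Fin N) ℂ))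
    {a : ℝ} (ha : 0 ≤ a)
    (hplaq : ∀ (x : Site P i) (κ μ : Fin P.d), κ ≠ μ → ‖((holT V x (plaqWord κ μ) : (Matrix (Fin N) (Fin N) ℂ)ˣ) : Matrix (Fin N) (Fin N) ℂ) - 1‖ ≤ a)
    (hsmall : N * P.d ^ 3 * (((P.L : ℝ) ^ e) ^ 2 * a) ^ 2 ≤ 1 / 2)
    (h : P.sitesPerDir i = P.L ^ e * P.sitesPerDir i') (Y : PBond P i → Matrix (Fin N) (Fin N) ℂ)
    (havg : ∀ c : PBond P i', ∑ r : Fin P.d → Fin (P.L ^ e), ∑ t ∈ range (P.L ^ e),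
        conjR (holT V (Site.fibreSite i e c.src fun _ => ⟨0, pow_pos P.L_pos e⟩) (treeWord fun ν => ((r ν : ℕ) : ℤ))
            * holT V (Site.fibreSite i e c.src r) (List.replicate t (c.dir, true)))
          (Y ⟨(fun z : Site P i => z.shift c.dir)^[t] (Site.fibreSite i e c.src r), c.dir⟩) = 0) :
    (((P.L : ℝ) ^ e) ^ 2)⁻¹ * ∑ b : PBond P i, ‖Y b‖ ^ 2
      ≤ (9 * N / 2) * ∑ b : PBond P i, ∑ ν : Fin P.d, ‖conjR (V ⟨b.src, ν⟩) (Y ⟨b.src.shift ν, b.dir⟩) - Y b‖ ^ 2 := by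
  have hmain := sum_normSq_le_covLineAvg_add_covGrad hV ha hplaq h Y
  simp only [havg, norm_zero] at hmain
  have hL : (0 : ℝ) < ((P.L : ℝ) ^ e) ^ 2 := by have := P.L_pos; positivity
  have hS0 : 0 ≤ ∑ b : PBond P i, ‖Y b‖ ^ 2 := Finset.sum_nonneg fun _ _ => sq_nonneg _
  have hG0 : 0 ≤ ∑ b : PBond P i, ∑ ν : Fin P.d, ‖conjR (V ⟨b.src, ν⟩) (Y ⟨b.src.shift ν, b.dir⟩) - Y b‖ ^ 2 :=
    Finset.sum_nonneg fun _ _ => Finset.sum_nonneg fun _ _ => sq_nonneg _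
  rw [inv_mul_le_iff₀ hL]
  have h1 := mul_le_mul_of_nonneg_right hsmall hS0
  norm_num at hmain
  nlinarith [hmain, h1]

/-- **`SU(N)` BACKGROUNDS** (the cell's `SU(N)` read in `M_N(ℂ)` through `unitsField ∘ toUField`, the letters of the carrier's regularity clause
`T3PrintedRegularMinimiser.DivSmall`): an `SU(N)` configuration is `U1`-valued, and the plaquette hypothesis of this file follows from `dist1 (U(∂p)) ≤ a`
for the positively oriented plaquettes (the other orientation is the inverse holonomy). [cite: Balaban1985Averaging, (19)-(20) p.21] -/
theorem hyp_of_specialUnitary (U : GaugeField P i (Matrix.specialUnitaryGroup (Fin N) ℂ)) {a : ℝ}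
    (hU : ∀ p : Plaq P i, dist1 (GaugeField.plaqHol U p) ≤ a) :
    (∀ b, unitsField (toUField U) b ∈ U1 (Matrix (Fin N) (Fin N) ℂ)) ∧
      ∀ (x : Site P i) (κ μ : Fin P.d), κ ≠ μ →
        ‖((holT (unitsField (toUField U)) x (plaqWord κ μ) : (Matrix (Fin N) (Fin N) ℂ)ˣ) : Matrix (Fin N) (Fin N) ℂ) - 1‖ ≤ a := by
  letI : CStarAlgebra (Matrix (Fin N) (Fin N) ℂ) := B10Eq29TubeLine.cstarAlgebraMatrix N
  have hV : ∀ b, unitsField (toUField U) b ∈ U1 (Matrix (Fin N) (Fin N) ℂ) :=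
    fun b => unitaryUnits_le_U1 (unitsField_mem_unitaryUnits (toUField U) b)
  refine ⟨hV, fun x κ μ hne => ?_⟩
  rcases lt_or_gt_of_ne hne with hlt | hgt
  · rw [norm_holT_unitsField_plaqWord_sub_one _ _ hlt, dist1_plaqHol_toUField]
    exact hU ⟨x, κ, μ, hlt⟩
  · rw [holT_plaqWord_swap]
    refine (B7Prop1Explicit.norm_inv_sub_one_le (holT_mem hV x _)).trans ?_
    rw [norm_holT_unitsField_plaqWord_sub_one _ _ hgt, dist1_plaqHol_toUField]
    exact hU ⟨x, μ, κ, hgt⟩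

/-- **THE COVARIANT COERCIVITY FOR AN `SU(N)` BACKGROUND WITH SMALL PLAQUETTE VARIABLES** (`dist1 (U₀(∂p)) ≤ a` for all `p`; `SU(N)` read in `M_N(ℂ)`):
the inequality of `sum_normSq_le_covLineAvg_add_covGrad` for `V = U₀`. [cite: Balaban1985BackgroundPropagators, Thm 3.11 p.416] -/
theorem sum_normSq_le_covLineAvg_add_covGrad_su (U₀ : GaugeField P i (Matrix.specialUnitaryGroup (Fin N) ℂ)) {a : ℝ} (ha : 0 ≤ a)
    (hU : ∀ p : Plaq P i, dist1 (GaugeField.plaqHol U₀ p) ≤ a)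
    (h : P.sitesPerDir i = P.L ^ e * P.sitesPerDir i') (Y : PBond P i → Matrix (Fin N) (Fin N) ℂ) :
    ∑ b : PBond P i, ‖Y b‖ ^ 2
      ≤ 2 * N * ((((P.L : ℝ) ^ e) ^ P.d) * ((P.L : ℝ) ^ e) ^ 2)⁻¹ *
          ∑ c : PBond P i', ‖∑ r : Fin P.d → Fin (P.L ^ e), ∑ t ∈ range (P.L ^ e),
              conjR (holT (unitsField (toUField U₀)) (Site.fibreSite i e c.src fun _ => ⟨0, pow_pos P.L_pos e⟩) (treeWord fun ν => ((r ν : ℕ) : ℤ))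
                  * holT (unitsField (toUField U₀)) (Site.fibreSite i e c.src r) (List.replicate t (c.dir, true)))
                (Y ⟨(fun z : Site P i => z.shift c.dir)^[t] (Site.fibreSite i e c.src r), c.dir⟩)‖ ^ 2
        + (9 * N / 4) * ((P.L : ℝ) ^ e) ^ 2 *
            ∑ b : PBond P i, ∑ ν : Fin P.d, ‖conjR (unitsField (toUField U₀) ⟨b.src, ν⟩) (Y ⟨b.src.shift ν, b.dir⟩) - Y b‖ ^ 2
        + N * P.d ^ 3 * (((P.L : ℝ) ^ e) ^ 2 * a) ^ 2 * ∑ b : PBond P i, ‖Y b‖ ^ 2 := by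
  obtain ⟨hV, hplaq⟩ := hyp_of_specialUnitary U₀ hU
  exact sum_normSq_le_covLineAvg_add_covGrad hV ha hplaq h Y

/-- **AT THE d = 3 CARRIER OF THE ROUTE** (`T3Thm1Carrier.varProblem3 F n K`: `SU(2)` configurations on the finest lattice `Site (F.P K) 0`, `e = K − n` averaging
levels; background `U₀` with `dist1 (U₀(∂p)) ≤ ε·L^{−2(K−n)}` — the plaquette clause of print's (6)/(14), non-strict): on the kernel of the covariant straight-line
averaging, `L^{−2(K−n)}·Σ_b‖Y(b)‖² ≤ 9·Σ_b Σ_ν ‖(∇^{U₀}_νY)(b)‖²` as soon as `108ε² ≤ 1` (`N = 2`, `d = 3`: `2·27·ε² ≤ ½`) — uniformly in the volume exponent `m`,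
in `n` and in `K`. [cite: Balaban1985BackgroundPropagators, Thm 3.11 p.416; Balaban1985Variational, (14) p.280] -/
theorem sum_normSq_le_covGrad_of_covLineAvg_eq_zero_T3 (F : T3ContinuumYM3Torus.T3Family) (n K : ℕ)
    (U₀ : GaugeField (F.P K) 0 (Matrix.specialUnitaryGroup (Fin 2) ℂ)) {ε : ℝ} (hε : 0 ≤ ε) (hε1 : 108 * ε ^ 2 ≤ 1)
    (hU : ∀ p : Plaq (F.P K) 0, dist1 (GaugeField.plaqHol U₀ p) ≤ ε * (((F.L : ℝ) ^ (K - n)) ^ 2)⁻¹)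
    (Y : PBond (F.P K) 0 → Matrix (Fin 2) (Fin 2) ℂ)
    (havg : ∀ c : PBond (F.P K) (K - n), ∑ r : Fin (F.P K).d → Fin ((F.P K).L ^ (K - n)), ∑ t ∈ range ((F.P K).L ^ (K - n)),
        conjR (holT (unitsField (toUField U₀)) (Site.fibreSite 0 (K - n) c.src fun _ => ⟨0, pow_pos (F.P K).L_pos (K - n)⟩)
              (treeWord fun ν => ((r ν : ℕ) : ℤ))
            * holT (unitsField (toUField U₀)) (Site.fibreSite 0 (K - n) c.src r) (List.replicate t (c.dir, true)))
          (Y ⟨(fun z : Site (F.P K) 0 => z.shift c.dir)^[t] (Site.fibreSite 0 (K - n) c.src r), c.dir⟩) = 0) :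
    (((F.L : ℝ) ^ (K - n)) ^ 2)⁻¹ * ∑ b : PBond (F.P K) 0, ‖Y b‖ ^ 2
      ≤ 9 * ∑ b : PBond (F.P K) 0, ∑ ν : Fin (F.P K).d,
          ‖conjR (unitsField (toUField U₀) ⟨b.src, ν⟩) (Y ⟨b.src.shift ν, b.dir⟩) - Y b‖ ^ 2 := by
  obtain ⟨hV, hplaq⟩ := hyp_of_specialUnitary U₀ hU
  have hLF : ((F.P K).L : ℝ) = (F.L : ℝ) := by norm_cast
  have hd : ((F.P K).d : ℝ) = 3 := by norm_num [T3ContinuumYM3Torus.T3Family.P_d]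
  have hL0 : (0 : ℝ) < ((F.L : ℝ) ^ (K - n)) ^ 2 := by
    have : (0 : ℝ) < F.L := by have := F.hL.2; exact_mod_cast (by omega : 0 < F.L)
    positivity
  have hsmall : ((2 : ℕ) : ℝ) * (F.P K).d ^ 3 * ((((F.P K).L : ℝ) ^ (K - n)) ^ 2 * (ε * (((F.L : ℝ) ^ (K - n)) ^ 2)⁻¹)) ^ 2 ≤ 1 / 2 := by
    rw [hLF, hd]
    have e1 : ((F.L : ℝ) ^ (K - n)) ^ 2 * (ε * (((F.L : ℝ) ^ (K - n)) ^ 2)⁻¹) = ε := by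
      rw [mul_comm ε, ← mul_assoc, mul_inv_cancel₀ hL0.ne', one_mul]
    rw [e1]
    push_cast
    nlinarith [hε1]
  have h := sum_normSq_le_covGrad_of_covLineAvg_eq_zero hV (by positivity) hplaq hsmall (Prop7FlatCoercivity.sitesPerDir_T3 F n K) Y havg
  rw [hLF] at h
  refine h.trans (le_of_eq ?_)
  norm_num

end BondFields

end Summit.QuantumFields.YangMills.Theorems.Prop7CovariantCoercivity

end
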